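import Summits.QuantumFields.YangMills.Theorems.UnitScaleTiltProp8EulerLagrangeIter
import Summits.QuantumFields.YangMills.Theorems.UnitScaleTiltProp8EulerLagrangeLie
import HarnessLib

/-!
# Route `UnitScaleTilt`, crux K1 «MinimiserStabilityRegPr» (stmt-QuantumFields-19200), stub `stub_prop8` (V2) — sub-lemma V2-EL, part 7g:
# **THE k-FOLD EULER–LAGRANGE EQUATION WITH THE MINIMAL MULTIPLIER SET** (`exists_tangent_lin_eq_zero_of_isCritR2_minimal`)

Cell `ym3-torus` ∕ fleet seat `ym-ust-19200-p2` g4.  Part 7d proved the k-fold Euler–Lagrange equation for R2-critical configurations with multipliers on the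
bottom set `T₀` of ANY tower of exceptional bond sets closed downwards under the central-bond maps `β` with `T_{K−n}` everything.  The sharpest statement takes
the INTERSECTION of all such towers — the iterated central bonds `β^{K−n}`(bonds of the `n`-th lattice), written impredicatively (no recursion, no definition):
`T^min_i = {b | b ∈ S_i for every admissible tower S}`.  It is itself admissible, so part 7d applies to it: for every finest bond `b₀` missed by SOME admissible
tower and every `X ∈ T_{U₀(b₀)}SU(2)` there is `ξ` with `ξ(b₀) = X U₀(b₀)^*`, `ξ(b) = 0` at every other bond missed by some admissible tower, and `Lin_{U₀}(ξ) = 0` —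
`3·#bonds_n` multipliers, the count of [Balaban1985Variational]'s `λ` on `Λ_k` in (133)∕(158).  Sorry-free, no definition. [folklore] ∕ cited.
References: T. Bałaban, CMP 102 (1985) 277–309 [Balaban1985Variational] ((127) p.297, (133) p.298, Prop 8 p.304); CMP 109 (1987) 249–301 [Balaban1987RG1] ((0.11) p.253).
-/

noncomputable section

open scoped BigOperators Matrix.Norms.L2Operator Matrix Topology
open Filter Function NormedSpace

namespace Summit.QuantumFields.YangMills.Theorems.Prop8Criticality

open Literature.MathematicalPhysics.QuantumFieldTheory.Balaban1983to89
open T4Continuum AveragingRT BlockAveraging BlockAveragingHaarAC BlockAveragingEMLHaarAC ExpMeanLog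
open T3ContinuumYM3Torus T3UnitLawDensityEML T3ConstrainedMinimiser T3TiltDescent T3DescentFibreTower
open T3PrintedRegularMinimiser T3RegularMinimiser T3Thm1CarrierNative
open Summit.QuantumFields.YangMills.Theorems.BlockAvgCorrector (stokesConst)
open BlockAveragingEMLHaarAC (emlWeight)

variable {P : Params}

/-- The intersection of all admissible towers (closed downwards under the central-bond maps below level `k`, everything at level `k`) is itself closed
downwards. [folklore] -/
theorem minimalTower_closed (k i : ℕ) (hi : i < k) (c : PBond P (i + 1))
    (hc : ∀ S : (l : ℕ) → Set (PBond P l), (∀ l, l < k → ∀ c' : PBond P (l + 1), c' ∈ S (l + 1) → centralBond c' ∈ S l) →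
      (∀ c' : PBond P k, c' ∈ S k) → c ∈ S (i + 1)) :
    ∀ S : (l : ℕ) → Set (PBond P l), (∀ l, l < k → ∀ c' : PBond P (l + 1), c' ∈ S (l + 1) → centralBond c' ∈ S l) →
      (∀ c' : PBond P k, c' ∈ S k) → centralBond c ∈ S i :=
  fun S hS hSk => hS i hi c (hc S hS hSk)

/-- Every level-`k` bond lies in the top set of the intersection of all admissible towers. [folklore] -/
theorem minimalTower_top (k : ℕ) (c : PBond P k) :
    ∀ S : (l : ℕ) → Set (PBond P l), (∀ l, l < k → ∀ c' : PBond P (l + 1), c' ∈ S (l + 1) → centralBond c' ∈ S l) →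
      (∀ c' : PBond P k, c' ∈ S k) → c ∈ S k :=
  fun _ _ hSk => hSk c

/-- **THE k-FOLD EULER–LAGRANGE EQUATION OF AN R2-CRITICAL CONFIGURATION, MINIMAL MULTIPLIER SET.**  Under the hypotheses of
`exists_tangent_lin_eq_zero_of_isCritR2_iter` (R2-critical `U₀` over `V`, run `K`, comparison height `n`, all iterated averages `t₀`-small with
`stokesConst·t₀ ≤ |I|⁻¹/1000`): for every finest bond `b₀` missed by SOME admissible tower (equivalently: not an iterated central bond `β^{K−n}(c)`) and every
differentiable `SU(2)`-curve `g` through `U₀(b₀)` with velocity `D₀`, there is `ξ` with `ξ(b₀) = D₀U₀(b₀)^*`, `ξ(b) = 0` at every other bond missed by some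
admissible tower, and `Lin_{U₀}(ξ) = 0` — the multipliers live on the iterated central bonds only, `3·#bonds_n` real parameters.
[cite: Balaban1985Variational, (127) p.297, (133) p.298, Prop 8 p.304; Balaban1987RG1, (0.11) p.253] -/
theorem exists_tangent_lin_eq_zero_of_isCritR2_minimal (F : T3Family) {n K : ℕ} (hnK : n ≤ K)
    {V : GaugeField (F.P n) 0 (Matrix.specialUnitaryGroup (Fin 2) ℂ)} {U₀ : GaugeField (F.P K) 0 (Matrix.specialUnitaryGroup (Fin 2) ℂ)}
    (hcrit : IsCritR2 F n K hnK V U₀)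
    {t₀ : ℝ} (ht₀ : 0 < t₀) (hsmall : stokesConst (F.P K) * t₀ ≤ emlWeight (F.P K) / 1000)
    (hU₀ : ∀ i, i < K - n → PlaqSmall t₀ (Averaging.iter (fun i => blockAvg (P := F.P K) (j := i) (expMeanLogSU (n := Fin 2))) i U₀))
    (b₀ : PBond (F.P K) 0)
    (hb₀ : ∃ S : (l : ℕ) → Set (PBond (F.P K) l), (∀ l, l < K - n → ∀ c : PBond (F.P K) (l + 1), c ∈ S (l + 1) → centralBond c ∈ S l) ∧
      (∀ c : PBond (F.P K) (K - n), c ∈ S (K - n)) ∧ b₀ ∉ S 0)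
    (g : ℝ → Matrix.specialUnitaryGroup (Fin 2) ℂ) (hg0 : g 0 = U₀ b₀) {D₀ : Matrix (Fin 2) (Fin 2) ℂ}
    (hg : HasDerivAt (fun t : ℝ => (g t : Matrix (Fin 2) (Fin 2) ℂ)) D₀ 0) :
    ∃ ξ : PBond (F.P K) 0 → Matrix (Fin 2) (Fin 2) ℂ,
      ξ b₀ = D₀ * star (U₀ b₀ : Matrix (Fin 2) (Fin 2) ℂ) ∧
      (∀ b : PBond (F.P K) 0, b ≠ b₀ →
        (∃ S : (l : ℕ) → Set (PBond (F.P K) l), (∀ l, l < K - n → ∀ c : PBond (F.P K) (l + 1), c ∈ S (l + 1) → centralBond c ∈ S l) ∧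
          (∀ c : PBond (F.P K) (K - n), c ∈ S (K - n)) ∧ b ∉ S 0) → ξ b = 0) ∧
      ∑ p : Plaq (F.P K) 0, (1 / 2) * ((((((GaugeField.plaqHol U₀ p : Matrix.specialUnitaryGroup (Fin 2) ℂ) : Matrix (Fin 2) (Fin 2) ℂ)) - 1)ᴴ
          * ((ξ ⟨p.src, p.μ⟩
              + (U₀ ⟨p.src, p.μ⟩ : Matrix (Fin 2) (Fin 2) ℂ) * ξ ⟨p.src.shift p.μ, p.ν⟩ * star (U₀ ⟨p.src, p.μ⟩ : Matrix (Fin 2) (Fin 2) ℂ)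
              - ((U₀ ⟨p.src, p.μ⟩ * U₀ ⟨p.src.shift p.μ, p.ν⟩ * (U₀ ⟨p.src.shift p.ν, p.μ⟩)⁻¹ : Matrix.specialUnitaryGroup (Fin 2) ℂ) : Matrix (Fin 2) (Fin 2) ℂ)
                  * ξ ⟨p.src.shift p.ν, p.μ⟩
                  * star ((U₀ ⟨p.src, p.μ⟩ * U₀ ⟨p.src.shift p.μ, p.ν⟩ * (U₀ ⟨p.src.shift p.ν, p.μ⟩)⁻¹ : Matrix.specialUnitaryGroup (Fin 2) ℂ) : Matrix (Fin 2) (Fin 2) ℂ)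
              - ((GaugeField.plaqHol U₀ p : Matrix.specialUnitaryGroup (Fin 2) ℂ) : Matrix (Fin 2) (Fin 2) ℂ) * ξ ⟨p.src, p.ν⟩
                  * star ((GaugeField.plaqHol U₀ p : Matrix.specialUnitaryGroup (Fin 2) ℂ) : Matrix (Fin 2) (Fin 2) ℂ))
            * ((GaugeField.plaqHol U₀ p : Matrix.specialUnitaryGroup (Fin 2) ℂ) : Matrix (Fin 2) (Fin 2) ℂ))).trace).re = 0 := by
  -- the minimal tower: the intersection of all admissible towers
  set T : (i : ℕ) → Set (PBond (F.P K) i) := fun i =>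
    {b | ∀ S : (l : ℕ) → Set (PBond (F.P K) l), (∀ l, l < K - n → ∀ c : PBond (F.P K) (l + 1), c ∈ S (l + 1) → centralBond c ∈ S l) →
      (∀ c : PBond (F.P K) (K - n), c ∈ S (K - n)) → b ∈ S i} with hT
  have hTclosed : ∀ i, i < K - n → ∀ c : PBond (F.P K) (i + 1), c ∈ T (i + 1) → centralBond c ∈ T i :=
    fun i hi c hc => minimalTower_closed (K - n) i hi c hc
  have hTtop : ∀ c : PBond (F.P K) (K - n), c ∈ T (K - n) := fun c => minimalTower_top (K - n) c
  have hnot : ∀ b : PBond (F.P K) 0,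
      (∃ S : (l : ℕ) → Set (PBond (F.P K) l), (∀ l, l < K - n → ∀ c : PBond (F.P K) (l + 1), c ∈ S (l + 1) → centralBond c ∈ S l) ∧
        (∀ c : PBond (F.P K) (K - n), c ∈ S (K - n)) ∧ b ∉ S 0) → b ∉ T 0 := by
    rintro b ⟨S, hS, hSk, hbS⟩ hbT
    exact hbS (hbT S hS hSk)
  obtain ⟨ξ, hξ₀, hξoff, hmain⟩ :=
    exists_tangent_lin_eq_zero_of_isCritR2_iter F hnK hcrit ht₀ hsmall hU₀ T hTclosed hTtop b₀ (hnot b₀ hb₀) g hg0 hg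
  exact ⟨ξ, hξ₀, fun b hb hbS => hξoff b hb (hnot b hbS), hmain⟩

/-- **THE SAME ALONG `𝔰𝔲(2)`**: velocity prescribed in the Lie algebra — for every `X` skew-Hermitian of trace zero and every finest bond `b₀` missed by some
admissible tower there is `ξ` with `ξ(b₀) = X`, `ξ = 0` at every other bond missed by some admissible tower, and `Lin_{U₀}(ξ) = 0` (the curve
`exp(tX)U₀(b₀)` is supplied internally, as in part 6's `exists_lieTangent_lin_eq_zero_of_isCritR2`). [cite: Balaban1985Variational, (127) p.297, (133) p.298] -/
theorem exists_lieTangent_lin_eq_zero_of_isCritR2_minimal (F : T3Family) {n K : ℕ} (hnK : n ≤ K)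
    {V : GaugeField (F.P n) 0 (Matrix.specialUnitaryGroup (Fin 2) ℂ)} {U₀ : GaugeField (F.P K) 0 (Matrix.specialUnitaryGroup (Fin 2) ℂ)}
    (hcrit : IsCritR2 F n K hnK V U₀)
    {t₀ : ℝ} (ht₀ : 0 < t₀) (hsmall : stokesConst (F.P K) * t₀ ≤ emlWeight (F.P K) / 1000)
    (hU₀ : ∀ i, i < K - n → PlaqSmall t₀ (Averaging.iter (fun i => blockAvg (P := F.P K) (j := i) (expMeanLogSU (n := Fin 2))) i U₀))
    (b₀ : PBond (F.P K) 0)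
    (hb₀ : ∃ S : (l : ℕ) → Set (PBond (F.P K) l), (∀ l, l < K - n → ∀ c : PBond (F.P K) (l + 1), c ∈ S (l + 1) → centralBond c ∈ S l) ∧
      (∀ c : PBond (F.P K) (K - n), c ∈ S (K - n)) ∧ b₀ ∉ S 0)
    {X : Matrix (Fin 2) (Fin 2) ℂ} (hX : X ∈ skewAdjoint (Matrix (Fin 2) (Fin 2) ℂ)) (htr : X.trace = 0) :
    ∃ ξ : PBond (F.P K) 0 → Matrix (Fin 2) (Fin 2) ℂ,
      ξ b₀ = X ∧
      (∀ b : PBond (F.P K) 0, b ≠ b₀ →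
        (∃ S : (l : ℕ) → Set (PBond (F.P K) l), (∀ l, l < K - n → ∀ c : PBond (F.P K) (l + 1), c ∈ S (l + 1) → centralBond c ∈ S l) ∧
          (∀ c : PBond (F.P K) (K - n), c ∈ S (K - n)) ∧ b ∉ S 0) → ξ b = 0) ∧
      ∑ p : Plaq (F.P K) 0, (1 / 2) * ((((((GaugeField.plaqHol U₀ p : Matrix.specialUnitaryGroup (Fin 2) ℂ) : Matrix (Fin 2) (Fin 2) ℂ)) - 1)ᴴ
          * ((ξ ⟨p.src, p.μ⟩
              + (U₀ ⟨p.src, p.μ⟩ : Matrix (Fin 2) (Fin 2) ℂ) * ξ ⟨p.src.shift p.μ, p.ν⟩ * star (U₀ ⟨p.src, p.μ⟩ : Matrix (Fin 2) (Fin 2) ℂ)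
              - ((U₀ ⟨p.src, p.μ⟩ * U₀ ⟨p.src.shift p.μ, p.ν⟩ * (U₀ ⟨p.src.shift p.ν, p.μ⟩)⁻¹ : Matrix.specialUnitaryGroup (Fin 2) ℂ) : Matrix (Fin 2) (Fin 2) ℂ)
                  * ξ ⟨p.src.shift p.ν, p.μ⟩
                  * star ((U₀ ⟨p.src, p.μ⟩ * U₀ ⟨p.src.shift p.μ, p.ν⟩ * (U₀ ⟨p.src.shift p.ν, p.μ⟩)⁻¹ : Matrix.specialUnitaryGroup (Fin 2) ℂ) : Matrix (Fin 2) (Fin 2) ℂ)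
              - ((GaugeField.plaqHol U₀ p : Matrix.specialUnitaryGroup (Fin 2) ℂ) : Matrix (Fin 2) (Fin 2) ℂ) * ξ ⟨p.src, p.ν⟩
                  * star ((GaugeField.plaqHol U₀ p : Matrix.specialUnitaryGroup (Fin 2) ℂ) : Matrix (Fin 2) (Fin 2) ℂ))
            * ((GaugeField.plaqHol U₀ p : Matrix.specialUnitaryGroup (Fin 2) ℂ) : Matrix (Fin 2) (Fin 2) ℂ))).trace).re = 0 := by
  -- the exponential curve through `U₀(b₀)` with velocity `X·U₀(b₀)`
  set g : ℝ → Matrix.specialUnitaryGroup (Fin 2) ℂ := fun t => ⟨exp (t • X) * (U₀ b₀ : Matrix (Fin 2) (Fin 2) ℂ), expCurve_mem hX htr (U₀ b₀) t⟩ with hgdef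
  have hg0 : g 0 = U₀ b₀ := by
    apply Subtype.ext
    show exp ((0 : ℝ) • X) * (U₀ b₀ : Matrix (Fin 2) (Fin 2) ℂ) = (U₀ b₀ : Matrix (Fin 2) (Fin 2) ℂ)
    rw [zero_smul, exp_zero, one_mul]
  have hg : HasDerivAt (fun t : ℝ => (g t : Matrix (Fin 2) (Fin 2) ℂ)) (X * (U₀ b₀ : Matrix (Fin 2) (Fin 2) ℂ)) 0 := by
    have h1 := (hasDerivAt_exp_smul_const' X (0 : ℝ)).mul_const (U₀ b₀ : Matrix (Fin 2) (Fin 2) ℂ)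
    simp only [zero_smul, exp_zero, mul_one] at h1
    exact h1
  obtain ⟨ξ, hξ₀, hξoff, hmain⟩ := exists_tangent_lin_eq_zero_of_isCritR2_minimal F hnK hcrit ht₀ hsmall hU₀ b₀ hb₀ g hg0 hg
  refine ⟨ξ, ?_, hξoff, hmain⟩
  rw [hξ₀, mul_assoc, Matrix.mem_unitaryGroup_iff.mp (U₀ b₀).2.1, mul_one]

end Summit.QuantumFields.YangMills.Theorems.Prop8Criticality

end
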